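import Mathlib
import Summits.QuantumAdvantage.QuantumAdvantage.Theorems.MobiusLadderQuadraticDigitPhasesStubOrbitGaussLemmas

/-!
# `QuadraticDigitPhases` (stmt-QuantumAdvantage-1391), line `Sketch` — stub `stub_orbitGauss`

The ORBIT BOUND WITH SUBGROUP ACCOUNTING (a staged component of `stub_rankCore`).

Setting: `V = Fin r → ZMod 2` acts freely (`act`) on a finite set `Good ⊆ ℕ`; a phase `ε` with
`|ε| ≤ 1` transforms along the action by the `±1`-valued function `(-1)^(Qd ω u)` of a map
`Qd ω : V → ZMod 2` of degree `≤ 2` (third differences vanish, `Qd ω 0 = 0`); the fibres of a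
labelling `lab` along an orbit are the cosets of the subgroup `K ω = {u | lab (act u ω) = lab ω}`.
Claim: `∑_e |∑_{ω ∈ Good, lab ω = e} ε ω| ≤ ∑_{ω ∈ Good} sqrt (|Rad K ω| / |K ω|) · 1[…]`, where
`Rad K ω = {u ∈ K ω | β ω u · ≡ 0 on K ω}` for the polar form `β ω u v = Qd ω (u+v) + Qd ω u + Qd ω v`
and the indicator asks that `Qd ω u = 0` for every `u ∈ K ω` with `β ω u · ≡ 0` on `V`.

Proof.  (1) `Good` is the disjoint union of the orbits `orb ω = {act u ω | u}` (each of size `2^r`,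
`act · ω` injective), and `∑_e |∑_{fibre e} ε| ≤ ∑_{orbits O} ∑_e |∑_{O ∩ fibre e} ε|`
(`Finset.sum_fiberwise_of_maps_to` for the map `ω ↦ orb ω`, triangle inequality).
(2) ORBIT BOUND at a base point `ω` (`orbit_bound`): the fibre of `e` in `orb ω` is
`{act u ω | lab (act u ω) = e}`, a coset `u₀ + K ω` (or empty), on which
`ε (act u ω) = (-1)^(Qd ω u) ε ω`; the coset Gauss-sum bound `fibre_bound` of the lemma file gives
`|∑_{coset} (-1)^(Qd ω u)| ≤ |coset| · sqrt (|Rad K ω| / |K ω|) · 1[…]`, and the cosets have total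
size `2^r`, so `∑_e |∑_{orb ω ∩ fibre e} ε| ≤ 2^r · W ω` (`W` = the right-hand summand).
(3) AVERAGING: the left side of (2) depends on `ω` only through its orbit, so applying (2) at every
point `ω'` of the orbit and averaging gives `∑_e |∑_{O ∩ fibre e} ε| ≤ ∑_{ω' ∈ O} W ω'` (no
translation rule for `Qd` along the orbit is needed).  Summing over the orbits gives the claim.
Stated without auxiliary definitions (the orbit map `orb` and the weight `W` are functions
with defining hypotheses `horb`, `hW`).  Elementary; Mathlib only.
-/

set_option linter.dupNamespace false -- D-0017: single-problem summit ⇒ `QuantumAdvantage.QuantumAdvantage` by design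

namespace Summit.QuantumAdvantage.QuantumAdvantage.Theorems.MobiusLadderQuadraticDigitPhasesStubOrbitGauss

open Finset
open Summit.QuantumAdvantage.QuantumAdvantage.Theorems.MobiusLadderQuadraticDigitPhasesStubOrbitGaussLemmas

variable {r : ℕ}

section Orbits

variable {Good : Finset ℕ} {act : (Fin r → ZMod 2) → ℕ → ℕ} {orb : ℕ → Finset ℕ}
  (horb : ∀ ω, orb ω = Finset.univ.image (fun u : Fin r → ZMod 2 => act u ω))
include horb

/-- Membership in an orbit. -/
theorem mem_orb {ω x : ℕ} : x ∈ orb ω ↔ ∃ u, act u ω = x := by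
  rw [horb]
  simp

omit horb in
/-- A free action of `V` on `Good`: `u ↦ act u ω` is injective for `ω ∈ Good`. -/
theorem act_injective (h0 : ∀ ω ∈ Good, act 0 ω = ω)
    (hadd : ∀ ω ∈ Good, ∀ u v, act (u + v) ω = act u (act v ω))
    (hfree : ∀ ω ∈ Good, ∀ u, act u ω = ω → u = 0) {ω : ℕ} (hω : ω ∈ Good) :
    Function.Injective (fun u : Fin r → ZMod 2 => act u ω) := by
  intro u v huv
  simp only at huv
  have h1 : act (u + u) ω = act (u + v) ω := by rw [hadd ω hω, hadd ω hω, huv]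
  rw [add_self, h0 ω hω] at h1
  have h2 := hfree ω hω (u + v) h1.symm
  calc u = u + v + v := (add_add_cancel u v).symm
    _ = v := by rw [h2, zero_add]

/-- `ω` lies in its own orbit. -/
theorem self_mem_orb (h0 : ∀ ω ∈ Good, act 0 ω = ω) {ω : ℕ} (hω : ω ∈ Good) : ω ∈ orb ω :=
  (mem_orb horb).mpr ⟨0, h0 ω hω⟩

/-- Orbits of points of `Good` stay inside `Good`. -/
theorem orb_subset (hcl : ∀ ω ∈ Good, ∀ u, act u ω ∈ Good) {ω : ℕ} (hω : ω ∈ Good) :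
    orb ω ⊆ Good := by
  intro x hx
  obtain ⟨u, rfl⟩ := (mem_orb horb).mp hx
  exact hcl ω hω u

/-- Orbits have exactly `2 ^ r` elements (free action). -/
theorem card_orb (h0 : ∀ ω ∈ Good, act 0 ω = ω)
    (hadd : ∀ ω ∈ Good, ∀ u v, act (u + v) ω = act u (act v ω))
    (hfree : ∀ ω ∈ Good, ∀ u, act u ω = ω → u = 0) {ω : ℕ} (hω : ω ∈ Good) :
    (orb ω).card = 2 ^ r := by
  rw [horb, Finset.card_image_of_injective _ (act_injective h0 hadd hfree hω), Finset.card_univ,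
    card_fun_zmod_two]

/-- All points of an orbit have the same orbit. -/
theorem orb_eq_of_mem (hadd : ∀ ω ∈ Good, ∀ u v, act (u + v) ω = act u (act v ω)) {ω : ℕ}
    (hω : ω ∈ Good) {ω' : ℕ} (hω' : ω' ∈ orb ω) : orb ω' = orb ω := by
  obtain ⟨u₀, rfl⟩ := (mem_orb horb).mp hω'
  ext x
  simp only [mem_orb horb]
  constructor
  · rintro ⟨v, rfl⟩
    exact ⟨v + u₀, hadd ω hω v u₀⟩
  · rintro ⟨v, rfl⟩
    refine ⟨v + u₀, ?_⟩
    rw [← hadd ω hω, add_add_cancel]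

/-- The orbit of `ω ∈ Good` is the set of points of `Good` with the same orbit (orbits partition
`Good`). -/
theorem mem_orb_iff (hcl : ∀ ω ∈ Good, ∀ u, act u ω ∈ Good) (h0 : ∀ ω ∈ Good, act 0 ω = ω)
    (hadd : ∀ ω ∈ Good, ∀ u v, act (u + v) ω = act u (act v ω)) {ω : ℕ} (hω : ω ∈ Good)
    {x : ℕ} : x ∈ orb ω ↔ x ∈ Good ∧ orb x = orb ω := by
  constructor
  · intro hx
    exact ⟨orb_subset horb hcl hω hx, orb_eq_of_mem horb hadd hω hx⟩
  · rintro ⟨hx, hxe⟩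
    rw [← hxe]
    exact self_mem_orb horb h0 hx

/-- `Good.filter (orb · = orb ω) = orb ω`. -/
theorem filter_orb_eq (hcl : ∀ ω ∈ Good, ∀ u, act u ω ∈ Good) (h0 : ∀ ω ∈ Good, act 0 ω = ω)
    (hadd : ∀ ω ∈ Good, ∀ u v, act (u + v) ω = act u (act v ω)) {ω : ℕ} (hω : ω ∈ Good) :
    Good.filter (fun x => orb x = orb ω) = orb ω := by
  ext x
  rw [Finset.mem_filter, mem_orb_iff horb hcl h0 hadd hω]

end Orbits

section OrbitBound

variable {Good : Finset ℕ} {act : (Fin r → ZMod 2) → ℕ → ℕ} {ε : ℕ → ℝ} {lab : ℕ → ℕ}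
  {Qd : ℕ → (Fin r → ZMod 2) → ZMod 2} {orb : ℕ → Finset ℕ}
  (horb : ∀ ω, orb ω = Finset.univ.image (fun u : Fin r → ZMod 2 => act u ω))
include horb

/-- The fibre sum of `ε` over an orbit, pulled back to `V`: `∑_{ω' ∈ orb ω, lab ω' = e} ε ω'
= ε ω · ∑_{u : lab (act u ω) = e} (-1)^(Qd ω u)`. -/
theorem orbit_fibre_sum (h0 : ∀ ω ∈ Good, act 0 ω = ω)
    (hadd : ∀ ω ∈ Good, ∀ u v, act (u + v) ω = act u (act v ω))
    (hfree : ∀ ω ∈ Good, ∀ u, act u ω = ω → u = 0)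
    (hchar : ∀ ω ∈ Good, ∀ u, ε (act u ω) = (-1 : ℝ) ^ (Qd ω u).val * ε ω)
    {ω : ℕ} (hω : ω ∈ Good) (e : ℕ) :
    ∑ ω' ∈ (orb ω).filter (fun ω' => lab ω' = e), ε ω' =
      ε ω * ∑ u ∈ univ.filter (fun u : Fin r → ZMod 2 => lab (act u ω) = e),
        (-1 : ℝ) ^ (Qd ω u).val := by
  rw [horb, Finset.filter_image, Finset.sum_image (act_injective h0 hadd hfree hω).injOn,
    Finset.mul_sum]
  refine Finset.sum_congr rfl fun u _ => ?_
  rw [hchar ω hω u, mul_comm]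

variable {W : ℕ → ℝ}
  (hW : ∀ ω, W ω =
    Real.sqrt (((Finset.univ.filter (fun u : Fin r → ZMod 2 => lab (act u ω) = lab ω ∧
          ∀ v : Fin r → ZMod 2, lab (act v ω) = lab ω → Qd ω (u + v) + Qd ω u + Qd ω v = 0)).card : ℝ) /
        ((Finset.univ.filter (fun u : Fin r → ZMod 2 => lab (act u ω) = lab ω)).card : ℝ)) *
      (if ∀ u : Fin r → ZMod 2, lab (act u ω) = lab ω →
          (∀ v : Fin r → ZMod 2, Qd ω (u + v) + Qd ω u + Qd ω v = 0) → Qd ω u = 0 then 1 else 0))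
include hW

/-- **Orbit bound at a base point.** `∑_e |∑_{ω' ∈ orb ω, lab ω' = e} ε ω'| ≤ 2^r · W ω`, where
`W ω = sqrt (|Rad K ω| / |K ω|) · 1[∀ u ∈ K ω, β ω u · ≡ 0 → Qd ω u = 0]`. -/
theorem orbit_bound (hcl : ∀ ω ∈ Good, ∀ u, act u ω ∈ Good) (h0 : ∀ ω ∈ Good, act 0 ω = ω)
    (hadd : ∀ ω ∈ Good, ∀ u v, act (u + v) ω = act u (act v ω))
    (hfree : ∀ ω ∈ Good, ∀ u, act u ω = ω → u = 0)
    (hε : ∀ ω ∈ Good, |ε ω| ≤ 1) (hQ0 : ∀ ω ∈ Good, Qd ω 0 = 0)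
    (hchar : ∀ ω ∈ Good, ∀ u, ε (act u ω) = (-1 : ℝ) ^ (Qd ω u).val * ε ω)
    (hdeg : ∀ ω ∈ Good, ∀ u v w, Qd ω (u + v + w) + Qd ω (u + v) + Qd ω (u + w) + Qd ω (v + w) +
      Qd ω u + Qd ω v + Qd ω w = 0)
    (hlab : ∀ ω ∈ Good, ∀ u v, lab (act u ω) = lab (act v ω) ↔ lab (act (u + v) ω) = lab ω)
    {ω : ℕ} (hω : ω ∈ Good) :
    ∑ e ∈ Good.image lab, |∑ ω' ∈ (orb ω).filter (fun ω' => lab ω' = e), ε ω'| ≤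
      (2 : ℝ) ^ r * W ω := by
  have hp0 : lab (act 0 ω) = lab ω := by rw [h0 ω hω]
  have hpadd : ∀ u v : Fin r → ZMod 2, lab (act u ω) = lab ω → lab (act v ω) = lab ω →
      lab (act (u + v) ω) = lab ω :=
    fun u v hu hv => (hlab ω hω u v).mp (hu.trans hv.symm)
  have key : ∀ e ∈ Good.image lab, |∑ ω' ∈ (orb ω).filter (fun ω' => lab ω' = e), ε ω'| ≤
      ((univ.filter (fun u : Fin r → ZMod 2 => lab (act u ω) = e)).card : ℝ) * W ω := by
    intro e _
    rw [orbit_fibre_sum horb h0 hadd hfree hchar hω e, abs_mul, hW]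
    by_cases hex : ∃ u₀ : Fin r → ZMod 2, lab (act u₀ ω) = e
    · obtain ⟨u₀, rfl⟩ := hex
      have hf : ∀ u : Fin r → ZMod 2,
          lab (act u ω) = lab (act u₀ ω) ↔ lab (act (u + u₀) ω) = lab ω :=
        fun u => hlab ω hω u u₀
      have hb := fibre_bound (fun u : Fin r → ZMod 2 => lab (act u ω) = lab ω) (Qd ω) hp0 hpadd
        (hQ0 ω hω) (hdeg ω hω) u₀ (fun u : Fin r → ZMod 2 => lab (act u ω) = lab (act u₀ ω)) hf
      calc |ε ω| * |∑ u ∈ univ.filter (fun u : Fin r → ZMod 2 => lab (act u ω) = lab (act u₀ ω)),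
              (-1 : ℝ) ^ (Qd ω u).val|
          ≤ 1 * |∑ u ∈ univ.filter (fun u : Fin r → ZMod 2 => lab (act u ω) = lab (act u₀ ω)),
              (-1 : ℝ) ^ (Qd ω u).val| := by
            gcongr
            exact hε ω hω
        _ ≤ _ := by rw [one_mul]; exact hb
    · have hempty : univ.filter (fun u : Fin r → ZMod 2 => lab (act u ω) = e) = ∅ :=
        Finset.filter_eq_empty_iff.mpr (fun u _ hu => hex ⟨u, hu⟩)
      rw [hempty]
      simp
  have hcount : ∑ e ∈ Good.image lab,
      ((univ.filter (fun u : Fin r → ZMod 2 => lab (act u ω) = e)).card : ℝ) = (2 : ℝ) ^ r := by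
    have hmaps : ∀ u ∈ (univ : Finset (Fin r → ZMod 2)), lab (act u ω) ∈ Good.image lab :=
      fun u _ => Finset.mem_image_of_mem lab (hcl ω hω u)
    have h := Finset.card_eq_sum_card_fiberwise hmaps
    rw [Finset.card_univ, card_fun_zmod_two] at h
    exact_mod_cast h.symm
  calc ∑ e ∈ Good.image lab, |∑ ω' ∈ (orb ω).filter (fun ω' => lab ω' = e), ε ω'|
      ≤ ∑ e ∈ Good.image lab,
          ((univ.filter (fun u : Fin r → ZMod 2 => lab (act u ω) = e)).card : ℝ) * W ω :=
        Finset.sum_le_sum key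
    _ = (2 : ℝ) ^ r * W ω := by rw [← Finset.sum_mul, hcount]

/-- **Main bound** (weight `W` as a function with its defining hypothesis):
`∑_e |∑_{ω ∈ Good, lab ω = e} ε ω| ≤ ∑_{ω ∈ Good} W ω`. -/
theorem sum_abs_fibre_le (hcl : ∀ ω ∈ Good, ∀ u, act u ω ∈ Good) (h0 : ∀ ω ∈ Good, act 0 ω = ω)
    (hadd : ∀ ω ∈ Good, ∀ u v, act (u + v) ω = act u (act v ω))
    (hfree : ∀ ω ∈ Good, ∀ u, act u ω = ω → u = 0)
    (hε : ∀ ω ∈ Good, |ε ω| ≤ 1) (hQ0 : ∀ ω ∈ Good, Qd ω 0 = 0)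
    (hchar : ∀ ω ∈ Good, ∀ u, ε (act u ω) = (-1 : ℝ) ^ (Qd ω u).val * ε ω)
    (hdeg : ∀ ω ∈ Good, ∀ u v w, Qd ω (u + v + w) + Qd ω (u + v) + Qd ω (u + w) + Qd ω (v + w) +
      Qd ω u + Qd ω v + Qd ω w = 0)
    (hlab : ∀ ω ∈ Good, ∀ u v, lab (act u ω) = lab (act v ω) ↔ lab (act (u + v) ω) = lab ω) :
    ∑ e ∈ Good.image lab, |∑ ω ∈ Good.filter (fun ω => lab ω = e), ε ω| ≤ ∑ ω ∈ Good, W ω := by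
  -- (1) split every fibre sum along the orbits and use the triangle inequality
  have hmaps : ∀ e, ∀ ω ∈ Good.filter (fun ω => lab ω = e), orb ω ∈ Good.image orb :=
    fun e ω hω => Finset.mem_image_of_mem _ (Finset.mem_filter.mp hω).1
  have step1 : ∑ e ∈ Good.image lab, |∑ ω ∈ Good.filter (fun ω => lab ω = e), ε ω| ≤
      ∑ O ∈ Good.image orb, ∑ e ∈ Good.image lab,
        |∑ ω ∈ (Good.filter (fun ω => lab ω = e)).filter (fun ω => orb ω = O), ε ω| := by
    rw [Finset.sum_comm]
    refine Finset.sum_le_sum fun e _ => ?_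
    calc |∑ ω ∈ Good.filter (fun ω => lab ω = e), ε ω|
        = |∑ O ∈ Good.image orb,
            ∑ ω ∈ (Good.filter (fun ω => lab ω = e)).filter (fun ω => orb ω = O), ε ω| := by
          rw [Finset.sum_fiberwise_of_maps_to (hmaps e)]
      _ ≤ _ := Finset.abs_sum_le_sum_abs _ _
  -- (2)+(3) the bound on each orbit, by averaging the base-point bound over the orbit
  have step2 : ∀ O ∈ Good.image orb, ∑ e ∈ Good.image lab,
      |∑ ω ∈ (Good.filter (fun ω => lab ω = e)).filter (fun ω => orb ω = O), ε ω| ≤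
        ∑ ω ∈ Good.filter (fun ω => orb ω = O), W ω := by
    intro O hO
    obtain ⟨ω₁, hω₁, rfl⟩ := Finset.mem_image.mp hO
    have hset : ∀ e, (Good.filter (fun ω => lab ω = e)).filter (fun ω => orb ω = orb ω₁) =
        (orb ω₁).filter (fun ω => lab ω = e) := by
      intro e
      ext x
      simp only [Finset.mem_filter, mem_orb_iff horb hcl h0 hadd hω₁]
      tauto
    simp_rw [hset]
    rw [filter_orb_eq horb hcl h0 hadd hω₁]
    have hT : ∀ ω' ∈ orb ω₁,
        ∑ e ∈ Good.image lab, |∑ ω ∈ (orb ω₁).filter (fun ω => lab ω = e), ε ω| ≤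
          (2 : ℝ) ^ r * W ω' := by
      intro ω' hω'
      have hω'G : ω' ∈ Good := orb_subset horb hcl hω₁ hω'
      rw [← orb_eq_of_mem horb hadd hω₁ hω']
      exact orbit_bound horb hW hcl h0 hadd hfree hε hQ0 hchar hdeg hlab hω'G
    have hsum := Finset.card_nsmul_le_sum (orb ω₁) (fun ω' => (2 : ℝ) ^ r * W ω') _ hT
    rw [card_orb horb h0 hadd hfree hω₁, ← Finset.mul_sum, nsmul_eq_mul] at hsum
    push_cast at hsum
    exact le_of_mul_le_mul_left hsum (by positivity)
  calc ∑ e ∈ Good.image lab, |∑ ω ∈ Good.filter (fun ω => lab ω = e), ε ω|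
      ≤ ∑ O ∈ Good.image orb, ∑ e ∈ Good.image lab,
          |∑ ω ∈ (Good.filter (fun ω => lab ω = e)).filter (fun ω => orb ω = O), ε ω| := step1
    _ ≤ ∑ O ∈ Good.image orb, ∑ ω ∈ Good.filter (fun ω => orb ω = O), W ω :=
        Finset.sum_le_sum step2
    _ = ∑ ω ∈ Good, W ω :=
        Finset.sum_fiberwise_of_maps_to (fun ω hω => Finset.mem_image_of_mem _ hω) _

end OrbitBound

/-- **Orbit bound with subgroup accounting** (stub `stub_orbitGauss` of the line `Sketch` of
`MobiusLadder.QuadraticDigitPhases`, a staged component of `stub_rankCore`): for a free action of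
`V = Fin r → ZMod 2` on `Good` along which `ε` transforms by `(-1)^(Qd ω u)` with `Qd ω` of degree
`≤ 2`, and a labelling whose fibres along orbits are the cosets of `K ω`,
`∑_e |∑_{lab = e} ε| ≤ ∑_ω sqrt (|Rad K ω| / |K ω|) · 1[Qd ω ≡ 0 on K ω ∩ Rad V]`. -/
theorem stub_orbitGauss :
    ∀ (r : ℕ) (Good : Finset ℕ) (act : (Fin r → ZMod 2) → ℕ → ℕ) (ε : ℕ → ℝ) (lab : ℕ → ℕ)
      (Qd : ℕ → (Fin r → ZMod 2) → ZMod 2),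
    (∀ ω ∈ Good, ∀ u, act u ω ∈ Good) →
    (∀ ω ∈ Good, act 0 ω = ω) →
    (∀ ω ∈ Good, ∀ u v, act (u + v) ω = act u (act v ω)) →
    (∀ ω ∈ Good, ∀ u, act u ω = ω → u = 0) →
    (∀ ω ∈ Good, |ε ω| ≤ 1) →
    (∀ ω ∈ Good, Qd ω 0 = 0) →
    (∀ ω ∈ Good, ∀ u, ε (act u ω) = (-1 : ℝ) ^ (Qd ω u).val * ε ω) →
    (∀ ω ∈ Good, ∀ u v w, Qd ω (u + v + w) + Qd ω (u + v) + Qd ω (u + w) + Qd ω (v + w) + Qd ω u + Qd ω v + Qd ω w = 0) →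
    (∀ ω ∈ Good, ∀ u v, lab (act u ω) = lab (act v ω) ↔ lab (act (u + v) ω) = lab ω) →
    ∑ e ∈ Good.image lab, |∑ ω ∈ Good.filter (fun ω => lab ω = e), ε ω| ≤
      ∑ ω ∈ Good,
        Real.sqrt (((Finset.univ.filter (fun u : Fin r → ZMod 2 => lab (act u ω) = lab ω ∧
              ∀ v : Fin r → ZMod 2, lab (act v ω) = lab ω → Qd ω (u + v) + Qd ω u + Qd ω v = 0)).card : ℝ) /
            ((Finset.univ.filter (fun u : Fin r → ZMod 2 => lab (act u ω) = lab ω)).card : ℝ)) *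
          (if ∀ u : Fin r → ZMod 2, lab (act u ω) = lab ω →
              (∀ v : Fin r → ZMod 2, Qd ω (u + v) + Qd ω u + Qd ω v = 0) → Qd ω u = 0 then 1 else 0) := by
  intro r Good act ε lab Qd hcl h0 hadd hfree hε hQ0 hchar hdeg hlab
  exact sum_abs_fibre_le (orb := fun ω => Finset.univ.image (fun u : Fin r → ZMod 2 => act u ω))
    (fun _ => rfl)
    (W := fun ω => Real.sqrt (((Finset.univ.filter (fun u : Fin r → ZMod 2 => lab (act u ω) = lab ω ∧
              ∀ v : Fin r → ZMod 2, lab (act v ω) = lab ω → Qd ω (u + v) + Qd ω u + Qd ω v = 0)).card : ℝ) /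
            ((Finset.univ.filter (fun u : Fin r → ZMod 2 => lab (act u ω) = lab ω)).card : ℝ)) *
          (if ∀ u : Fin r → ZMod 2, lab (act u ω) = lab ω →
              (∀ v : Fin r → ZMod 2, Qd ω (u + v) + Qd ω u + Qd ω v = 0) → Qd ω u = 0 then 1 else 0))
    (fun _ => rfl) hcl h0 hadd hfree hε hQ0 hchar hdeg hlab

end Summit.QuantumAdvantage.QuantumAdvantage.Theorems.MobiusLadderQuadraticDigitPhasesStubOrbitGauss
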